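import Literature.Probability.Percolation.NearCriticalRSW
import Literature.Probability.Percolation.NearCriticalExpDecay
import Literature.Probability.Percolation.NearCriticalRSWStart
import Literature.Probability.Percolation.KestenScalingFromFacts
import Literature.Probability.Percolation.NearCriticalLengthsEquivalence
import HarnessLib

/-!
# The supercritical radius decay beyond `L_ε(p)`: reductions (proofs only)

Topic `Literature/Probability/Percolation`; family `crit-perc`. Proofs only (no new definition, no
new named fact): the dependency structure, inside the tree, of the `p > 1/2` annulus display at
EVERY `ε ∈ (0, 1/2)` — `∀ ε ∈ (0, 1/2), Nolin2008_radius_decay_supercritical_at ε`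
(`NearCriticalCorrelationLength.lean`: for `p > 1/2` near `1/2` with `L = L_ε(p) ≥ 1` and all
`k ≥ 1`, `P_p(0 ↝ ∂S_{kL}, |C(0)| < ∞) ≤ C e^{-ck}`; Nolin 2008, §7.5, proof of Lemma 44
[arXiv 0711.4948: Lemma 42], second annulus display). This all-`ε` statement was a named fact
(a decomposition child of `Nolin2008_radius_decay`) until the review of the decomposition
(D-0027, 2026-08-15) MERGED it back into its parent, of which it is the restriction to `p > 1/2`
(`Nolin2008_radius_decay_supercritical_at_of_radius_decay_at`, `NearCriticalRadiusDecayFromTwoFacts.lean`);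
the theorems below that concluded it now conclude the unfolded statement
`∀ ε : ℝ, 0 < ε → ε < 1 / 2 → Nolin2008_radius_decay_supercritical_at ε` (called "the all-`ε`
statement" in this file), the second hypothesis of `Nolin2008_radius_decay_of_halves`.

* `Nolin2008_radius_decay_supercritical_of_lemma39`: the all-`ε` statement follows from the tree's
  `Nolin2008_lemma39` (`NearCriticalArm.lean`: Nolin's Lemma 39 / Remark 40 at every
  `ε ∈ (0, 1/2)`), by `Nolin2008_lemma39_at_of_lemma39` (`NearCriticalExpDecay.lean`) and the
  white-crossing argument `Nolin2008_radius_decay_supercritical_at_of_lemma39_at`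
  (`NearCriticalFiniteClusterDecay.lean`); hence also both halves, `Nolin2008_radius_decay_of_lemma39`.
* `Nolin2008_radius_decay_supercritical_at_of_RSW_one`: for every `ε` below the RSW threshold
  `ε₀`, the single-`ε` statement follows from the "moreover" clause `Nolin2008_RSW_one` of Nolin's
  RSW theorem alone (`Nolin2008_lemma39_at_small`, `NearCriticalRSW.lean`) — the range in which
  Nolin proves Lemma 39 directly ("we have proved the property for any `ε` below some fixed value
  `ε₀` (given by RSW)", proof of Lemma 39 [arXiv: Lemma 37]).
* `Nolin2008_radius_decay_supercritical_at_anti`: monotonicity in `ε` — the statement at `ε`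
  implies the statement at every `ε' ≤ ε`, because `L_ε(p) ≤ L_{ε'}(p)` (`charLength_anti`,
  Nolin 2008, proof of Cor. 37 [arXiv: Cor. 35 (lengths)]) and the arm events decrease with the radius. So the
  content of the all-`ε` statement beyond `Nolin2008_RSW_one` is exactly its content for `ε` close to
  `1/2`, where Nolin's proof invokes the equivalence of lengths `L_ε ≍ L_{ε'}` (Cor. 37
  [arXiv: Cor. 35], from Kesten's relation, Prop. 34 [arXiv: Prop. 32], and the comparison of four
  and five arms) — not in the tree; this is what keeps `Nolin2008_radius_decay` (and
  `Nolin2008_lemma39`) a named fact today.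
* (2026-08-15, `### Three leaves`) Nolin's Lemma 39 at every small `ε` is now a THEOREM of the
  tree (`Nolin2008_lemma39_at_holds_small`, `NearCriticalRSWStart.lean`), and the equivalence of
  lengths has been reduced to named facts (`charLength_le_mul_charLength_of_scaling`,
  `NearCriticalLengthsEquivalence.lean`). Hence: the single-`ε` statement holds UNCONDITIONALLY for
  every small `ε` (`Nolin2008_radius_decay_supercritical_at_holds_small`), and the all-`ε` statement
  follows from three named facts and no Russo–Seymour–Welsh hypothesis — Kesten's relation
  `Nolin2008_prop34` and Werner's two critical four-arm estimates `Werner2009_fourArm_quasiMult`,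
  `Werner2009_fourArm_lowerBound` (`Nolin2008_radius_decay_supercritical_of_scaling`; variants
  `…_of_lemma62`, `…_of_wernerFacts`; the third estimate is a theorem,
  `Werner2009_fourArm_lowerBound_holds`, `FiveArmLowerBound.lean`), exactly like the parent
  (`Nolin2008_radius_decay_of_scaling`).

## References

* P. Nolin, Near-critical percolation in two dimensions, *Electron. J. Probab.* 13 (2008), §3.1
  Thm. "Russo–Seymour–Welsh", §7.3 Cor. 37, §7.4 Lemma 39 / Remark 40, §7.5 proof of Lemma 44
  (EJP numbering; arXiv 0711.4948: Thm. 2, Cor. 35, Lemma 37 / Remark 38, Lemma 42) [Nolin2008].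

Tree: `Nolin2008_radius_decay_supercritical_at`, `Nolin2008_radius_decay_of_halves`,
`Nolin2008_radius_decay_subcritical_at_of_lemma39_at`, `triBoxArm_anti`
(`NearCriticalCorrelationLength.lean`), `Nolin2008_radius_decay_supercritical_at_of_lemma39_at`
(`NearCriticalFiniteClusterDecay.lean`), `Nolin2008_lemma39_at_of_lemma39`
(`NearCriticalExpDecay.lean`), `Nolin2008_lemma39_at_small`, `one_le_charLength`,
`Nolin2008_subcritical_crossing_holds` (`NearCriticalRSW.lean`), `charLength_anti`
(`KestenRelationRussoProofs.lean`), `charLength_symm` (`KestenScaling.lean`). Mathlib: measure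
monotonicity only; no percolation.
-/

noncomputable section

open MeasureTheory Set Filter Topology
open scoped unitInterval

namespace Literature.Probability.Percolation

open LatticeModels

/-! ### From Lemma 39 at every `ε` -/

/-- **`Nolin2008_lemma39 →` the supercritical radius decay at every `ε`.** Nolin's uniform exponential
decay above `L_ε(p)` at every `ε ∈ (0, 1/2)` (the tree's `Nolin2008_lemma39`) implies the
supercritical radius decay of the finite cluster of the origin at every `ε ∈ (0, 1/2)` (Nolin 2008,
§7.5, proof of Lemma 44, second annulus display, "deduced from the sub-critical case"; here through
white crossings, `Nolin2008_radius_decay_supercritical_at_of_lemma39_at`). [cite: Nolin2008, §7.5 (proof of Lemma 44 (arXiv: Lemma 42)), §7.4 Lemma 39 / Remark 40 (arXiv: Lemma 37 / Remark 38)] -/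
theorem Nolin2008_radius_decay_supercritical_of_lemma39 (h39 : Nolin2008_lemma39) :
    ∀ ε : ℝ, 0 < ε → ε < 1 / 2 → Nolin2008_radius_decay_supercritical_at ε := fun _ hε hε' =>
  Nolin2008_radius_decay_supercritical_at_of_lemma39_at (Nolin2008_lemma39_at_of_lemma39 h39 hε hε')

/-- **`Nolin2008_lemma39 → Nolin2008_radius_decay`** (both halves of the radius decay beyond
`L_ε(p)`, every `ε ∈ (0, 1/2)`). [cite: Nolin2008, §7.5 (proof of Lemma 44 (arXiv: Lemma 42)), §7.4 Lemma 39 / Remark 40 (arXiv: Lemma 37 / Remark 38)] -/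
theorem Nolin2008_radius_decay_of_lemma39 (h39 : Nolin2008_lemma39) : Nolin2008_radius_decay :=
  Nolin2008_radius_decay_of_halves
    (fun _ hε hε' =>
      Nolin2008_radius_decay_subcritical_at_of_lemma39_at (Nolin2008_lemma39_at_of_lemma39 h39 hε hε'))
    (Nolin2008_radius_decay_supercritical_of_lemma39 h39)

/-! ### Small `ε`: from the RSW clause `f_k(δ) → 1` alone -/

/-- **The supercritical radius decay at every small `ε`, from `Nolin2008_RSW_one`.** There is
`ε₀ > 0` (the RSW threshold of `Nolin2008_lemma39_at_small`) such that
`Nolin2008_radius_decay_supercritical_at ε` holds for every `0 < ε ≤ ε₀` — the range in which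
Nolin proves Lemma 39 without the equivalence of lengths. [cite: Nolin2008, §7.4 Lemma 39 (proof, "for any ε below some fixed value ε₀ (given by RSW)"; arXiv: Lemma 37), §7.5 (proof of Lemma 44 (arXiv: Lemma 42))] -/
theorem Nolin2008_radius_decay_supercritical_at_of_RSW_one (hone : Nolin2008_RSW_one) :
    ∃ ε₀ > (0 : ℝ), ∀ ⦃ε : ℝ⦄, 0 < ε → ε ≤ ε₀ → Nolin2008_radius_decay_supercritical_at ε := by
  obtain ⟨ε₀, hε₀, h⟩ := Nolin2008_lemma39_at_small hone
  exact ⟨ε₀, hε₀, fun ε hε hεle => Nolin2008_radius_decay_supercritical_at_of_lemma39_at (h hε hεle)⟩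

/-! ### Monotonicity in `ε` -/

/-- For `1/2 < p < 1 - ε` (and `0 < ε`), the characteristic length `L_ε(p) = L_ε(1 - p)` is at
least `1` (the single site is crossed at the dual parameter with probability `1 - p > ε`, and the
crossing probabilities at `1 - p < 1/2` do tend to `0`, `Nolin2008_subcritical_crossing_holds`). [folklore] -/
theorem one_le_charLength_of_half_lt {ε : ℝ} (hε : 0 < ε) {p : unitInterval} (hp : (1 / 2 : ℝ) < p)
    (hpε : (p : ℝ) < 1 - ε) : 1 ≤ charLength ε p := by
  have hq : ((σ p : unitInterval) : ℝ) < 1 / 2 := by rw [unitInterval.coe_symm_eq]; linarith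
  have hεq : ε < ((σ p : unitInterval) : ℝ) := by rw [unitInterval.coe_symm_eq]; linarith
  rw [← charLength_symm]
  exact one_le_charLength Nolin2008_subcritical_crossing_holds hε hεq hq

/-- **Monotonicity in `ε` of the supercritical radius decay.** If
`Nolin2008_radius_decay_supercritical_at ε` holds and `0 < ε' ≤ ε < 1/2`, then
`Nolin2008_radius_decay_supercritical_at ε'` holds, with the same `C`, `c` and
`δ' = min δ (1/2 - ε)`: for `1/2 < p < 1 - ε` one has `1 ≤ L_ε(p) ≤ L_{ε'}(p)` (`charLength_anti`;
Nolin 2008, proof of Cor. 37 [arXiv: Cor. 35]: "assume that `ε ≤ ε'`, so that `L_ε(p) ≥ L_{ε'}(p)`"), so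
`{0 ↝ ∂S_{k L_{ε'}(p)}} ⊆ {0 ↝ ∂S_{k L_ε(p)}}` (`triBoxArm_anti`). Thus the all-`ε` statement
`∀ ε ∈ (0, 1/2), Nolin2008_radius_decay_supercritical_at ε` is equivalent to its instances at `ε`
arbitrarily close to `1/2`. [cite: Nolin2008, §7.3, proof of Cor. 37 (arXiv 0711.4948: Cor. 35)] -/
theorem Nolin2008_radius_decay_supercritical_at_anti {ε ε' : ℝ} (hε' : 0 < ε') (hle : ε' ≤ ε)
    (hε : ε < 1 / 2) (h : Nolin2008_radius_decay_supercritical_at ε) :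
    Nolin2008_radius_decay_supercritical_at ε' := by
  obtain ⟨δ, hδ, C, hC, c, hc, h⟩ := h
  refine ⟨min δ (1 / 2 - ε), lt_min hδ (by linarith), C, hC, c, hc, fun p hp hpδ _ k hk => ?_⟩
  have hpδ' : (p : ℝ) < 1 / 2 + δ := lt_of_lt_of_le hpδ (by linarith [min_le_left δ (1 / 2 - ε)])
  have hpε : (p : ℝ) < 1 - ε := by linarith [min_le_right δ (1 / 2 - ε)]
  have hL : 1 ≤ charLength ε p := one_le_charLength_of_half_lt (lt_of_lt_of_le hε' hle) hp hpε
  -- `L_ε(p) ≤ L_{ε'}(p)` (the tree's `charLength_anti`, `KestenRelationRussoProofs.lean`; re-derived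
  -- here from the definition: the scale `L_{ε'}(p)` has dual crossing probability `≤ ε' ≤ ε`)
  have hLL : charLength ε p ≤ charLength ε' p := by
    have hq : ((σ p : unitInterval) : ℝ) < 1 / 2 := by rw [unitInterval.coe_symm_eq]; linarith
    have hmin : min p (σ p) = σ p :=
      min_eq_right (Subtype.coe_le_coe.1 (by rw [unitInterval.coe_symm_eq]; linarith))
    have hne : {n : ℕ | triLRCrossingProb (min p (σ p)) n n ≤ ε'}.Nonempty := by
      obtain ⟨n, hn⟩ := ((Nolin2008_subcritical_crossing_holds (σ p) hq).eventually
        (gt_mem_nhds hε')).exists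
      exact ⟨n, by rw [Set.mem_setOf_eq, hmin]; exact hn.le⟩
    exact Nat.sInf_le ((triLRCrossingProb_charLength_le hne).trans hle)
  have hkL : 1 ≤ k * charLength ε p := le_trans hL (Nat.le_mul_of_pos_left _ hk)
  calc (triSitePercolation p).real
        (triBoxArm (k * charLength ε' p) ∩ (sitePercolatesAt triGraph 0)ᶜ)
      ≤ (triSitePercolation p).real
          (triBoxArm (k * charLength ε p) ∩ (sitePercolatesAt triGraph 0)ᶜ) :=
        measureReal_mono
          (Set.inter_subset_inter_left _ (triBoxArm_anti hkL (Nat.mul_le_mul_left k hLL)))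
          (measure_ne_top _ _)
    _ ≤ C * Real.exp (-(c * k)) := h p hp hpδ' hL k hk

/-- **The all-`ε` statement from its instances near `1/2`.** If for every `η > 0` there is
`ε ∈ [1/2 - η, 1/2)` at which `Nolin2008_radius_decay_supercritical_at ε` holds, then it holds at
every `ε ∈ (0, 1/2)`. [cite: Nolin2008, §7.3, proof of Cor. 37 (arXiv 0711.4948: Cor. 35); §7.5 (proof of Lemma 44 (arXiv: Lemma 42))] -/
theorem Nolin2008_radius_decay_supercritical_of_near_half
    (h : ∀ η : ℝ, 0 < η → ∃ ε : ℝ, 1 / 2 - η ≤ ε ∧ ε < 1 / 2 ∧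
      Nolin2008_radius_decay_supercritical_at ε) :
    ∀ ε : ℝ, 0 < ε → ε < 1 / 2 → Nolin2008_radius_decay_supercritical_at ε := by
  intro ε' hε' hε'2
  obtain ⟨ε, hle, hε, hG⟩ := h (1 / 2 - ε') (by linarith)
  exact Nolin2008_radius_decay_supercritical_at_anti hε' (by linarith) hε hG

/-! ## The truncated two-point function: `ξ* ≍ L_ε`, and Smirnov–Werner's Thm. 1 (iv) from the leaves

This part RESTORES the eighteen theorems of proposal p28057 (agent
`literature-prover-facts-…Smirn-2bbbb07750-0`, provefact `SmirnovWerner2001_truncCorrLength_exponent`),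
which created this very file a few seconds before the first part above was proposed as a NEW file
under the same name (p28102) and were thereby removed from the tree (the gate recorded
`decls-removed`; nothing referenced them yet). Statements are the ones recorded by the gate for
p28057, verbatim; the proofs are re-derived here after the radius-correlation-length template of
`NearCriticalCorrelationLengthLower.lean` (`exp_le_real_triOneArm_finite_of_chain`,
`charLength_div_le_triCorrLength_le_of_chain`, `triCorrLength_exponent_of_chain_charLength`).

Content (Smirnov–Werner 2001, §2: `ξ*(p)` defined by
`P_p[0 ↔ x by a finite cluster] = exp (-x / ξ*(p) + o(x))`, Thm. 1 (iv) `ξ*(p) = (p - 1/2)^{-4/3+o(1)}`;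
Nolin 2008, §7.2, Theorem "Critical exponents" [arXiv: Thm. 31], `ξ ≍ L`):
* the RSW-type construction for the truncated two-point function `τ^f_p(0, n e₀)`
  (`sides_cross_frame_subset_triFinConn`): if both vertical sides of `[0, n] × [0, h]` are open,
  the parallelogram is crossed horizontally by open sites and the square annulus at scale
  `M = n + h + 1` carries a closed frame, then `0` and `n e₀` lie in the same finite open cluster;
  whence (`exp_le_triTruncTwoPoint_of_chain`, chained RSW bound `ChainBound ε` below `L_ε(p)`,
  Harris–FKG and disjoint-support independence) `τ^f_p(0, n e₀) ≥ p^{2L} η^{37} e^{-(34 |log η| / L) n}`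
  for `L = L_ε(p) ≥ 2`, `n ≥ 1`, unconditionally (`exp_le_triTruncTwoPoint_holds`);
* the sandwich `L_ε(p) / C₂ ≤ ξ*(p) ≤ 2 L_ε(p) / c` wherever the truncated radius decays beyond
  `L_ε(p)` at rate `c` (`charLength_div_le_triTruncCorrLength_le_of_chain` / `_le` / `_le_holds`;
  upper half through `τ^f ≤ P(0 ↔ ∂Λ_n, |C(0)| < ∞)`, `triFinConn_axis_subset`, and
  `div_le_limsup_rateSeq_of_radius_decay`);
* the assemblies of the named fact `SmirnovWerner2001_truncCorrLength_exponent`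
  (`NearCriticalCorrelationLength.lean`) from the same leaves as `triCorrLength_exponent`:
  `…_of_chain_charLength`, `…_of_charLength_decay`, `…_of_charLength_at`, `…_of_lemma39_at`,
  `…_of_scaling`, `…_of_leaves₃ : fourArm_exponent → Werner2009_lemma62 → Nolin2008_RSW_one → SW (iv)`,
  `…_of_leaves₃'` (with `Nolin2008_RSW_thm`). The discharge `…_holds` stays blocked upstream on
  `fourArm_exponent`, `Werner2009_lemma62`, `Nolin2008_RSW_one`.
* (2026-08-15, third part, `### Two leaves`) Nolin's Lemma 39 at every small `ε` is now a theorem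
  of the tree (`Nolin2008_lemma39_at_holds_small`, `NearCriticalRSWStart.lean`, from the two-scale
  Russo–Seymour–Welsh bounds), which removes `Nolin2008_RSW_one` from the leaves:
  `…_of_prop34 : fourArm_exponent → Nolin2008_prop34 → SW (iv)`,
  `…_of_leaves₂ : fourArm_exponent → Werner2009_lemma62 → SW (iv)` (Kesten's relation from the
  pivotal count, `Nolin2008_prop34_of_expDecay`), and `…_of_wernerFacts` (Kesten's relation from the
  five named facts of Werner's Lecture 6, `Nolin2008_prop34_of_wernerFacts`,
  `KestenScalingFromFacts.lean`). The discharge `…_holds` is `…_of_prop34 fourArm_exponent_holds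
  Nolin2008_prop34_holds`, blocked upstream on `fourArm_exponent` (Smirnov–Werner 2001, Thm. 4, the
  SLE₆ computation) and on `Nolin2008_prop34` (through `Werner2009_lemma62` or Werner's five facts).

References for this part: S. Smirnov, W. Werner, *Math. Res. Lett.* 8 (2001), §2, Thm. 1 (iv)
[SmirnovWernerMRL2001]; P. Nolin, *Electron. J. Probab.* 13 (2008), §3.1, §7.2–7.5 [Nolin2008];
G. Grimmett, *Percolation* (1999), (8.49), (8.57), (9.17) [GrimmettPercolation1999]; B. Bollobás,
O. Riordan, *Percolation* (2006), Ch. 3, Lemma 4, Cor. 5 [BollobasRiordan2006]. Tree: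
`triFinConn`, `triTruncTwoPoint`, `triTruncCorrLength(Real)`, `triAxisSite`,
`triFinConn_axis_subset`, `rateSeq_anti`, `div_le_limsup_rateSeq_of_radius_decay`,
`tendsto_log_div_of_sandwich` (`NearCriticalCorrelationLength.lean`); `ChainBound`,
`chainBound_holds`, `chainBound_of_RSW`, `pathIn_leftSide`, `leftSide_open_event`,
`disjoint_strip_annulus`, `limsup_rateSeq_le_of_exp_le`, `tendsto_log_div_const_div`
(`NearCriticalCorrelationLengthLower.lean`); `triClosedFrame`,
`siteCluster_subset_box_of_mem_triClosedFrame`, `pow_four_le_real_triClosedFrame`,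
`determinedBy_triClosedFrame_annulus`, `triHCross` (`TriRSWChaining.lean`);
`mem_siteCluster_of_pathIn` (`TriLadder.lean`); `card_leftSide_le` (`KestenTheorem.lean`).
-/

/-! ### The open right side of `[0, n] × [0, h]` -/

/-- `(n, t) ∈ rightSide n h` for `t ≤ h`. [folklore] -/
theorem axis_mem_rightSide {n h t : ℕ} (ht : t ≤ h) : (![(n : ℤ), (t : ℤ)] : Site 2) ∈ rightSide n h := by
  refine Finset.mem_filter.2 ⟨mem_rectangle_iff.2 ?_, ?_⟩
  · simp only [Matrix.cons_val_zero, Matrix.cons_val_one, Matrix.cons_val_fin_one]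
    omega
  · simp

/-- The axis site `n e₀ = (n, 0)` in coordinates. [folklore] -/
theorem triAxisSite_eq (n : ℕ) : triAxisSite n = ![(n : ℤ), ((0 : ℕ) : ℤ)] := by
  rw [Site.eq_iff_two, triAxisSite_apply_zero, triAxisSite_apply_one]
  simp

/-- If the right side of `R(n, h)` is open, the axis site `n e₀` is joined by open sites of it to
each of its sites. [folklore] -/
theorem pathIn_rightSide {ω : SiteConfig (Site 2)} {n h : ℕ} (hω : (↑(rightSide n h) : Set (Site 2)) ⊆ ω)
    (t : ℕ) (ht : t ≤ h) : PathIn triGraph ω (triAxisSite n) ![(n : ℤ), (t : ℤ)] := by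
  induction t with
  | zero =>
    rw [triAxisSite_eq]
    exact PathIn.refl (hω (Finset.mem_coe.2 (axis_mem_rightSide (Nat.zero_le h))))
  | succ t ih =>
    refine (ih (by omega)).tail ?_ (hω (Finset.mem_coe.2 (axis_mem_rightSide ht)))
    exact zdGraph_le_triGraph (zdGraph_two_adj_of_coord (Or.inr (Or.inr (Or.inl
      ⟨by simp, by simp⟩))))

/-- `|rightSide m n| ≤ n + 1`. [folklore] -/
theorem card_rightSide_le (m n : ℕ) : (rightSide m n).card ≤ n + 1 := by
  have hsub : rightSide m n ⊆ (Finset.range (n + 1)).image fun t : ℕ => (![(m : ℤ), (t : ℤ)] : Site 2) := by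
    intro x hx
    simp only [rightSide, Finset.mem_filter, mem_rectangle_iff] at hx
    obtain ⟨⟨-, -, h1, h2⟩, h0⟩ := hx
    refine Finset.mem_image.2 ⟨(x 1).toNat, Finset.mem_range.2 (by omega), ?_⟩
    rw [Site.eq_iff_two]
    simp only [Matrix.cons_val_zero, Matrix.cons_val_one, Matrix.cons_val_fin_one]
    exact ⟨h0.symm, Int.toNat_of_nonneg h1⟩
  exact (Finset.card_le_card hsub).trans (Finset.card_image_le.trans (Finset.card_range _).le)

/-- The event "both vertical sides of `R(n, h)` are open" is determined by the sites of the
parallelogram `[0, n] × [0, h]`, increasing, and of probability `≥ p^{2(h+1)}`. [folklore] -/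
theorem sides_open_event (p : unitInterval) (n h : ℕ) :
    DeterminedBy {ω : SiteConfig (Site 2) | (↑(leftSide n h ∪ rightSide n h) : Set (Site 2)) ⊆ ω}
        ↑(triStripFinset 0 0 n h) ∧
      IsUpperSet {ω : SiteConfig (Site 2) | (↑(leftSide n h ∪ rightSide n h) : Set (Site 2)) ⊆ ω} ∧
      (p : ℝ) ^ (2 * (h + 1)) ≤ (triSitePercolation p).real
        {ω : SiteConfig (Site 2) | (↑(leftSide n h ∪ rightSide n h) : Set (Site 2)) ⊆ ω} := by
  have hsub : (↑(leftSide n h ∪ rightSide n h) : Set (Site 2)) ⊆ ↑(triStripFinset 0 0 n h) := by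
    intro z hz
    rw [Finset.mem_coe, Finset.mem_union] at hz
    rw [coe_triStripFinset, mem_triStrip]
    rcases hz with hz | hz
    · have h1 := mem_rectangle_iff.1 (Finset.mem_filter.1 hz).1
      omega
    · have h1 := mem_rectangle_iff.1 (Finset.mem_filter.1 hz).1
      omega
  refine ⟨?_, fun ω ω' hle hω => Set.Subset.trans hω hle, ?_⟩
  · rw [determinedBy_iff]
    intro ω ω' hω
    simp only [Set.mem_setOf_eq]
    constructor
    · intro h1 v hv
      have : v ∈ ω ∩ ↑(triStripFinset 0 0 n h) := ⟨h1 hv, hsub hv⟩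
      rw [hω] at this; exact this.1
    · intro h1 v hv
      have : v ∈ ω' ∩ ↑(triStripFinset 0 0 n h) := ⟨h1 hv, hsub hv⟩
      rw [← hω] at this; exact this.1
  · unfold triSitePercolation
    rw [sitePercolation_real_subset]
    refine pow_le_pow_of_le_one p.2.1 p.2.2 ?_
    calc (leftSide n h ∪ rightSide n h).card ≤ (leftSide n h).card + (rightSide n h).card :=
          Finset.card_union_le _ _
      _ ≤ (h + 1) + (h + 1) := add_le_add (card_leftSide_le n h) (card_rightSide_le n h)
      _ = 2 * (h + 1) := by ring

/-! ### The construction: `0` and `n e₀` in the same finite cluster -/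

/-- **The construction for `τ^f`.** If both vertical sides `{0} × [0, h]`, `{n} × [0, h]` of
`[0, n] × [0, h]` are open, `[0, n] × [0, h]` is crossed horizontally by open sites, and the
square annulus `S_{2M} ∖ S_M°` (`M = n + h + 1`) carries a closed frame, then `0` and `n e₀`
belong to the same open cluster (up the left side, along the crossing, down the right side),
which is confined to `S_{2M}` (`siteCluster_subset_box_of_mem_triClosedFrame`), hence finite:
the configuration lies in `triFinConn 0 (n e₀)`. [folklore] -/
theorem sides_cross_frame_subset_triFinConn (n h : ℕ) :
    ({ω : SiteConfig (Site 2) | (↑(leftSide n h ∪ rightSide n h) : Set (Site 2)) ⊆ ω} ∩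
        triHCross 0 0 n h) ∩ triClosedFrame (n + h + 1) ⊆ triFinConn 0 (triAxisSite n) := by
  rintro ω ⟨⟨hsides, hcross⟩, hframe⟩
  have hcolL : (↑(leftSide n h) : Set (Site 2)) ⊆ ω := fun z hz =>
    hsides (by rw [Finset.coe_union]; exact Or.inl hz)
  have hcolR : (↑(rightSide n h) : Set (Site 2)) ⊆ ω := fun z hz =>
    hsides (by rw [Finset.coe_union]; exact Or.inr hz)
  obtain ⟨x, y, hx0, hy0, hpath⟩ := hcross
  have hx := hpath.left_mem.1
  have hy := hpath.right_mem.1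
  simp only [mem_triStrip] at hx hy
  -- `x = (0, t)`, `y = (n, s)` with `0 ≤ t, s ≤ h`
  obtain ⟨t, ht⟩ : ∃ t : ℕ, (t : ℤ) = x 1 := ⟨(x 1).toNat, Int.toNat_of_nonneg hx.2.2.1⟩
  obtain ⟨s, hs⟩ : ∃ s : ℕ, (s : ℤ) = y 1 := ⟨(y 1).toNat, Int.toNat_of_nonneg hy.2.2.1⟩
  have hxe : x = ![(0 : ℤ), (t : ℤ)] := by
    rw [Site.eq_iff_two]; simp [hx0, ht]
  have hye : y = ![(n : ℤ), (s : ℤ)] := by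
    rw [Site.eq_iff_two]; simp [hy0, hs]
  have hth : t ≤ h := by have := hx.2.2.2; omega
  have hsh : s ≤ h := by have := hy.2.2.2; omega
  have p1 : PathIn triGraph ω 0 x := by rw [hxe]; exact pathIn_leftSide hcolL t hth
  have p2 : PathIn triGraph ω x y := hpath.mono Set.inter_subset_right
  have p3 : PathIn triGraph ω y (triAxisSite n) := by
    rw [hye]; exact (pathIn_rightSide hcolR s hsh).symm
  exact ⟨mem_siteCluster_of_pathIn ((p1.trans p2).trans p3),
    (Finset.finite_toSet _).subset (siteCluster_subset_box_of_mem_triClosedFrame (by omega) hframe)⟩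

/-! ### The lower bound `τ^f_p(0, n e₀) ≥ c₁ e^{-C₂ n / L_ε(p)}` -/

/-- **The lower bound for the truncated two-point function.** Fix `ε ∈ (0, 1/2)` and assume the
chained bound `ChainBound ε` with `η = η(ε)`. For every `p` with `L = L_ε(p) ≥ 2` and every
`n ≥ 1`, `τ^f_p(0, n e₀) ≥ p^{2L} · η^{37} · exp (-(34 |log η| / L) · n)`: the two open sides
(`p^{2L}`), the open crossing of `[0, n] × [0, L-1]` (`η^{j₁}`, `j₁ = ⌊n/(L-1)⌋ + 1`) and the
closed frame at scale `M = n + L` (`(η^{j₂})⁴`, `j₂ = ⌊4M/(L-1)⌋ + 1 ≤ 8n/L + 9`), combined by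
Harris–FKG and disjoint-support independence (Nolin 2008, §7.4, display before Cor. 42: "a
RSW-type construction yields `P_p(𝒞_H([0, k L] × [0, L])) ≥ δ₂^{k-1} δ₁^{k-2} = C₁ e^{-C₂ k}`";
Smirnov–Werner 2001, §2, for `ξ*`). [cite: Nolin2008, §7.4 (display before Cor. 42 (arXiv: Cor. 40))] -/
theorem exp_le_triTruncTwoPoint_of_chain {ε : ℝ} (hchain0 : ChainBound ε) :
    ∃ η : ℝ, 0 < η ∧ η ≤ 1 ∧ ∀ p : unitInterval, 2 ≤ charLength ε p → ∀ n : ℕ, 1 ≤ n →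
      (p : ℝ) ^ (2 * charLength ε p) * η ^ 37 *
          Real.exp (-(34 * |Real.log η| / charLength ε p * n)) ≤
        triTruncTwoPoint p 0 (triAxisSite n) := by
  obtain ⟨η, hη, hη1, hchain⟩ := hchain0
  refine ⟨η, hη, hη1, fun p hL n hn => ?_⟩
  set L := charLength ε p with hLdef
  set h := L - 1 with hh
  have hh1 : 1 ≤ h := by omega
  set M := n + h + 1 with hM
  -- the three events
  set Acol : Set (SiteConfig (Site 2)) :=
    {ω | (↑(leftSide n h ∪ rightSide n h) : Set (Site 2)) ⊆ ω} with hAcol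
  set Across : Set (SiteConfig (Site 2)) := triHCross 0 0 n h with hAcross
  set Aframe : Set (SiteConfig (Site 2)) := triClosedFrame M with hAframe
  obtain ⟨hcol_det, hcol_up, hcol_P⟩ := sides_open_event p n h
  -- probabilities of the pieces
  set j₁ := n / h + 1 with hj₁
  set j₂ := 4 * M / h + 1 with hj₂
  have hj₁1 : 1 ≤ j₁ := Nat.le_add_left 1 _
  have hj₂1 : 1 ≤ j₂ := Nat.le_add_left 1 _
  have hw₁ : n ≤ (j₁ + 1) * (L - 1) := by
    rw [← hh, hj₁]
    have := Nat.div_add_mod n h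
    have := Nat.mod_lt n (show 0 < h by omega)
    nlinarith
  have hw₂ : 4 * M ≤ (j₂ + 1) * (L - 1) := by
    rw [← hh, hj₂]
    have := Nat.div_add_mod (4 * M) h
    have := Nat.mod_lt (4 * M) (show 0 < h by omega)
    nlinarith
  have hcross_P : η ^ j₁ ≤ (triSitePercolation p).real Across := by
    rw [hAcross, triSitePercolation_real_triHCross]
    exact hchain p p (min_symm_le p).1 hL j₁ n hj₁1 hw₁
  have hframe_P : (η ^ j₂) ^ 4 ≤ (triSitePercolation p).real Aframe := by
    refine le_trans ?_ (pow_four_le_real_triClosedFrame p M)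
    have h0 : 0 ≤ η ^ j₂ := pow_nonneg hη.le _
    have h1 : η ^ j₂ ≤ triLRCrossingProb (σ p) (4 * M) M :=
      calc η ^ j₂ ≤ triLRCrossingProb (σ p) (4 * M) h :=
            hchain p (σ p) (min_symm_le p).2 hL j₂ (4 * M) hj₂1 hw₂
        _ ≤ triLRCrossingProb (σ p) (4 * M) M := triLRCrossingProb_mono_height _ _ (by omega)
    exact pow_le_pow_left₀ h0 h1 4
  -- Harris for the two open events, independence from the closed frame
  have hcross_det : DeterminedBy Across ↑(triStripFinset 0 0 n h) := determinedBy_triHCross 0 0 n h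
  have hAB_det : DeterminedBy (Acol ∩ Across) ↑(triStripFinset 0 0 n h) := hcol_det.inter hcross_det
  have hHarris : (triSitePercolation p).real Acol * (triSitePercolation p).real Across ≤
      (triSitePercolation p).real (Acol ∩ Across) :=
    sitePercolation_harris' p hcol_det hcross_det hcol_up (isUpperSet_triHCross 0 0 n h)
  have hindep : (triSitePercolation p).real ((Acol ∩ Across) ∩ Aframe) =
      (triSitePercolation p).real (Acol ∩ Across) * (triSitePercolation p).real Aframe :=
    sitePercolation_real_inter_of_disjoint p hAB_det
      (determinedBy_triClosedFrame_annulus (M := M) (by omega)) (disjoint_strip_annulus n h)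
  -- exponent bookkeeping: `j₁ ≤ 2n/L + 1`, `j₂ ≤ 8n/L + 9`
  have hhL1 : h + 1 = L := by omega
  have hLpos : (0 : ℝ) < L := by exact_mod_cast (show 0 < L by omega)
  have hLh : (L : ℝ) = h + 1 := by exact_mod_cast hhL1.symm
  have hhL : (L : ℝ) ≤ 2 * h := by
    have : L ≤ 2 * h := by omega
    exact_mod_cast this
  have hn0 : (0 : ℝ) ≤ n := Nat.cast_nonneg n
  have hj₁r : (j₁ : ℝ) ≤ 2 * n / L + 1 := by
    have hK : ((n / h : ℕ) : ℝ) * h ≤ n := by exact_mod_cast Nat.div_mul_le_self n h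
    have hK0 : (0 : ℝ) ≤ (n / h : ℕ) := Nat.cast_nonneg _
    have hKL := mul_le_mul_of_nonneg_left hhL hK0
    have h1 : (j₁ : ℝ) = (n / h : ℕ) + 1 := by rw [hj₁]; push_cast; ring
    have h2 : (j₁ : ℝ) * L ≤ 2 * n + L := by rw [h1]; nlinarith
    rw [← sub_le_iff_le_add, le_div_iff₀ hLpos]
    nlinarith
  have hj₂r : (j₂ : ℝ) ≤ 8 * n / L + 9 := by
    have hK : ((4 * M / h : ℕ) : ℝ) * h ≤ (4 * M : ℕ) := by exact_mod_cast Nat.div_mul_le_self (4 * M) h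
    have hK0 : (0 : ℝ) ≤ (4 * M / h : ℕ) := Nat.cast_nonneg _
    have hKL := mul_le_mul_of_nonneg_left hhL hK0
    have hM4 : ((4 * M : ℕ) : ℝ) = 4 * n + 4 * L := by rw [hM]; push_cast; rw [hLh]; ring
    have h1 : (j₂ : ℝ) = (4 * M / h : ℕ) + 1 := by rw [hj₂]; push_cast; ring
    have h2 : (j₂ : ℝ) * L ≤ 8 * n + 9 * L := by rw [h1]; nlinarith
    rw [← sub_le_iff_le_add, le_div_iff₀ hLpos]
    nlinarith
  have hJ : (j₁ : ℝ) + 4 * j₂ ≤ 37 + 34 * n / L := by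
    have : (34 : ℝ) * n / L = 2 * n / L + 4 * (8 * n / L) := by ring
    linarith
  have hlogη : Real.log η ≤ 0 := Real.log_nonpos hη.le hη1
  have habs : |Real.log η| = -Real.log η := abs_of_nonpos hlogη
  have hexp : η ^ 37 * Real.exp (-(34 * |Real.log η| / L * n)) ≤ η ^ j₁ * (η ^ j₂) ^ 4 := by
    have hR : η ^ j₁ * (η ^ j₂) ^ 4 = Real.exp (((j₁ : ℝ) + 4 * j₂) * Real.log η) := by
      rw [← pow_mul, ← pow_add, ← Real.exp_log (pow_pos hη (j₁ + j₂ * 4)), Real.log_pow]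
      congr 1
      push_cast
      ring
    have hL' : η ^ 37 * Real.exp (-(34 * |Real.log η| / L * n)) =
        Real.exp ((37 + 34 * n / L) * Real.log η) := by
      rw [← Real.exp_log (pow_pos hη 37), ← Real.exp_add, Real.log_pow, habs]
      congr 1
      push_cast
      ring
    rw [hR, hL', Real.exp_le_exp]
    have : 0 ≤ ((j₁ : ℝ) + 4 * j₂ - (37 + 34 * n / L)) * Real.log η :=
      mul_nonneg_of_nonpos_of_nonpos (by linarith) hlogη
    linarith
  -- conclusion
  have hcol_P' : (p : ℝ) ^ (2 * L) ≤ (triSitePercolation p).real Acol := by rwa [hhL1] at hcol_P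
  show _ ≤ (triSitePercolation p).real (triFinConn 0 (triAxisSite n))
  calc (p : ℝ) ^ (2 * L) * η ^ 37 * Real.exp (-(34 * |Real.log η| / L * n))
      = (p : ℝ) ^ (2 * L) * (η ^ 37 * Real.exp (-(34 * |Real.log η| / L * n))) := by ring
    _ ≤ (triSitePercolation p).real Acol * (η ^ j₁ * (η ^ j₂) ^ 4) :=
        mul_le_mul hcol_P' hexp (by positivity) measureReal_nonneg
    _ = ((triSitePercolation p).real Acol * η ^ j₁) * (η ^ j₂) ^ 4 := by ring
    _ ≤ ((triSitePercolation p).real Acol * (triSitePercolation p).real Across) *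
          (triSitePercolation p).real Aframe :=
        mul_le_mul (mul_le_mul_of_nonneg_left hcross_P measureReal_nonneg) hframe_P
          (pow_nonneg (pow_nonneg hη.le _) 4) (mul_nonneg measureReal_nonneg measureReal_nonneg)
    _ ≤ (triSitePercolation p).real (Acol ∩ Across) * (triSitePercolation p).real Aframe :=
        mul_le_mul_of_nonneg_right hHarris measureReal_nonneg
    _ = (triSitePercolation p).real ((Acol ∩ Across) ∩ Aframe) := hindep.symm
    _ ≤ (triSitePercolation p).real (triFinConn 0 (triAxisSite n)) :=
        measureReal_mono (sides_cross_frame_subset_triFinConn n h) (measure_ne_top _ _)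

/-- **The lower bound for `τ^f`, unconditionally** (`ChainBound ε` holds, `chainBound_holds`). [cite: Nolin2008, §7.4 (display before Cor. 42 (arXiv: Cor. 40))] [cite: BollobasRiordan2006, Ch. 3 Lemma 4, Cor. 5] -/
theorem exp_le_triTruncTwoPoint_holds {ε : ℝ} (hε : 0 < ε) (hε' : ε < 1 / 2) :
    ∃ η : ℝ, 0 < η ∧ η ≤ 1 ∧ ∀ p : unitInterval, 2 ≤ charLength ε p → ∀ n : ℕ, 1 ≤ n →
      (p : ℝ) ^ (2 * charLength ε p) * η ^ 37 *
          Real.exp (-(34 * |Real.log η| / charLength ε p * n)) ≤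
        triTruncTwoPoint p 0 (triAxisSite n) :=
  exp_le_triTruncTwoPoint_of_chain (chainBound_holds hε hε')

/-! ### `ξ* ≍ L_ε` -/

/-- **`ξ* ≍ L_ε` near criticality** (Smirnov–Werner 2001, §2, paragraph after Thm. 1: the
correlation length `ξ*` is comparable to the finite-size scaling length; Nolin 2008, §7.2, Theorem
"Critical exponents" [arXiv: Thm. 31], `ξ ≍ L`). Fix `ε` and assume `ChainBound ε`. There is
`C₂ = C₂(ε) > 0` such that for every `p > 0` with `L = L_ε(p) ≥ 2` at which the truncated radius
decays beyond `L` at rate `c` with constant `C` (`P_p(0 ↝ ∂S_{kL}, |C(0)| < ∞) ≤ C e^{-ck}`,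
`k ≥ 1`): `L / C₂ ≤ ξ*(p) ≤ 2 L / c`. The lower bound is `exp_le_triTruncTwoPoint_of_chain`
(`limsup_rateSeq_le_of_exp_le`); the upper bound is `τ^f_p(0, n e₀) ≤ P_p(0 ↔ ∂Λ_n, |C(0)| < ∞)`
(`triFinConn_axis_subset`, Grimmett (8.57)) and `div_le_limsup_rateSeq_of_radius_decay`. [cite: SmirnovWernerMRL2001, §2 (paragraph after Thm. 1)] [cite: Nolin2008, §7.2 Thm. "Critical exponents" (arXiv: Thm. 31)] -/
theorem charLength_div_le_triTruncCorrLength_le_of_chain {ε : ℝ} (hchain0 : ChainBound ε) :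
    ∃ C₂ : ℝ, 0 < C₂ ∧ ∀ p : unitInterval, 0 < (p : ℝ) → 2 ≤ charLength ε p →
      ∀ {C c : ℝ}, 0 < C → 0 < c →
        (∀ k : ℕ, 1 ≤ k → (triSitePercolation p).real
          (triBoxArm (k * charLength ε p) ∩ (sitePercolatesAt triGraph 0)ᶜ) ≤
            C * Real.exp (-(c * k))) →
        (charLength ε p : ℝ) / C₂ ≤ triTruncCorrLength p ∧
          triTruncCorrLength p ≤ 2 * charLength ε p / c := by
  obtain ⟨η, hη, hη1, hlow⟩ := exp_le_triTruncTwoPoint_of_chain hchain0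
  refine ⟨34 * |Real.log η| + 1, by positivity, fun p hp0 hL C c hC hc hdec => ?_⟩
  set L := charLength ε p with hLdef
  set F : Set (SiteConfig (Site 2)) := (sitePercolatesAt triGraph 0)ᶜ with hF
  set P : ℕ → ℝ := fun n => (triSitePercolation p).real (triOneArm n ∩ F) with hP
  set τ : ℕ → ℝ := fun n => triTruncTwoPoint p 0 (triAxisSite n) with hτ
  have hLpos : (0 : ℝ) < L := by exact_mod_cast (show 0 < L by omega)
  have ha : 0 < (p : ℝ) ^ (2 * L) * η ^ 37 := mul_pos (pow_pos hp0 _) (pow_pos hη 37)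
  -- the lower bound on `τ n`, with the weaker rate `(34 |log η| + 1) / L`
  have hlowτ : ∀ n : ℕ, 1 ≤ n →
      (p : ℝ) ^ (2 * L) * η ^ 37 * Real.exp (-((34 * |Real.log η| + 1) / L * n)) ≤ τ n := by
    intro n hn
    refine le_trans ?_ (hlow p hL n hn)
    have hexp_le : Real.exp (-((34 * |Real.log η| + 1) / L * n)) ≤
        Real.exp (-(34 * |Real.log η| / L * n)) := by
      rw [Real.exp_le_exp, neg_le_neg_iff]
      have hn0 : (0 : ℝ) ≤ n := Nat.cast_nonneg n
      have : 34 * |Real.log η| / L ≤ (34 * |Real.log η| + 1) / L :=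
        div_le_div_of_nonneg_right (by linarith) hLpos.le
      exact mul_le_mul_of_nonneg_right this hn0
    exact mul_le_mul_of_nonneg_left hexp_le ha.le
  obtain ⟨hbddτ, hlimτ⟩ := limsup_rateSeq_le_of_exp_le ha (fun n => measureReal_le_one)
    (fun n => measureReal_nonneg) hlowτ
  -- `τ n ≤ P n` (Grimmett (8.57)), positivity, and the comparison of the rates
  have hτP : ∀ n, 1 ≤ n → τ n ≤ P n := fun n hn =>
    measureReal_mono (triFinConn_axis_subset hn) (measure_ne_top _ _)
  have hτpos : ∀ n, 1 ≤ n → 0 < τ n := fun n hn =>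
    (mul_pos ha (Real.exp_pos _)).trans_le (hlowτ n hn)
  have hPpos : ∀ n, 1 ≤ n → 0 < P n := fun n hn => (hτpos n hn).trans_le (hτP n hn)
  have hle : ∀ᶠ n in atTop, rateSeq P n ≤ rateSeq τ n :=
    (eventually_ge_atTop 1).mono fun n hn => rateSeq_anti (hτpos n hn) (hτP n hn)
  have hbddP : IsBoundedUnder (· ≤ ·) atTop (rateSeq P) := hbddτ.mono_le hle
  have hrP0 : ∀ n, 0 ≤ rateSeq P n := fun n => rateSeq_nonneg measureReal_nonneg measureReal_le_one
  have h3 : limsup (rateSeq P) atTop ≤ limsup (rateSeq τ) atTop :=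
    limsup_le_limsup hle (isCoboundedUnder_le_of_le atTop hrP0) hbddτ
  have hlow' : c / (2 * L) ≤ limsup (rateSeq P) atTop :=
    div_le_limsup_rateSeq_of_radius_decay p (by omega) hC hc hdec hPpos hbddP
  have hlowτ' : c / (2 * L) ≤ limsup (rateSeq τ) atTop := hlow'.trans h3
  have hpos : 0 < limsup (rateSeq τ) atTop := lt_of_lt_of_le (by positivity) hlowτ'
  have hax : triTruncCorrLength p = (limsup (rateSeq τ) atTop)⁻¹ := rfl
  constructor
  · rw [hax, div_eq_mul_inv, ← one_div]
    calc (L : ℝ) * (1 / (34 * |Real.log η| + 1))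
        = ((34 * |Real.log η| + 1) / L)⁻¹ := by rw [inv_div]; ring
      _ ≤ (limsup (rateSeq τ) atTop)⁻¹ := inv_anti₀ hpos hlimτ
  · rw [hax]
    calc (limsup (rateSeq τ) atTop)⁻¹ ≤ (c / (2 * L))⁻¹ := inv_anti₀ (by positivity) hlowτ'
      _ = 2 * L / c := by rw [inv_div]

/-- **`ξ* ≍ L_ε`** from `Nolin2008_RSW` (aspect ratio `2`). [cite: Nolin2008, §7.2 Thm. "Critical exponents" (arXiv: Thm. 31), §3.1 Thm. "Russo–Seymour–Welsh" (arXiv: Thm. 2)] -/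
theorem charLength_div_le_triTruncCorrLength_le (hRSW : Nolin2008_RSW) {ε : ℝ} (hε : 0 < ε)
    (hε' : ε < 1 / 2) :
    ∃ C₂ : ℝ, 0 < C₂ ∧ ∀ p : unitInterval, 0 < (p : ℝ) → 2 ≤ charLength ε p →
      ∀ {C c : ℝ}, 0 < C → 0 < c →
        (∀ k : ℕ, 1 ≤ k → (triSitePercolation p).real
          (triBoxArm (k * charLength ε p) ∩ (sitePercolatesAt triGraph 0)ᶜ) ≤
            C * Real.exp (-(c * k))) →
        (charLength ε p : ℝ) / C₂ ≤ triTruncCorrLength p ∧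
          triTruncCorrLength p ≤ 2 * charLength ε p / c :=
  charLength_div_le_triTruncCorrLength_le_of_chain (chainBound_of_RSW hRSW hε hε')

/-- **`ξ* ≍ L_ε`, unconditionally in the RSW input.** [cite: SmirnovWernerMRL2001, §2 (paragraph after Thm. 1)] [cite: Nolin2008, §7.2 Thm. "Critical exponents" (arXiv: Thm. 31)] [cite: BollobasRiordan2006, Ch. 3 Lemma 4, Cor. 5] -/
theorem charLength_div_le_triTruncCorrLength_le_holds {ε : ℝ} (hε : 0 < ε) (hε' : ε < 1 / 2) :
    ∃ C₂ : ℝ, 0 < C₂ ∧ ∀ p : unitInterval, 0 < (p : ℝ) → 2 ≤ charLength ε p →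
      ∀ {C c : ℝ}, 0 < C → 0 < c →
        (∀ k : ℕ, 1 ≤ k → (triSitePercolation p).real
          (triBoxArm (k * charLength ε p) ∩ (sitePercolatesAt triGraph 0)ᶜ) ≤
            C * Real.exp (-(c * k))) →
        (charLength ε p : ℝ) / C₂ ≤ triTruncCorrLength p ∧
          triTruncCorrLength p ≤ 2 * charLength ε p / c :=
  charLength_div_le_triTruncCorrLength_le_of_chain (chainBound_holds hε hε')

/-! ### Smirnov–Werner's Thm. 1 (iv) from the leaves -/

/-- **Smirnov–Werner 2001, Thm. 1 (iv), from the chained bound, the power law of `L_ε` and the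
radius decay.** If `ChainBound ε` holds, if the characteristic length `L_ε` obeys the two-sided
power law `-4/3` at `1/2` (`KestenScaling.lean`, from `fourArm_exponent` and `Nolin2008_prop34`),
and if the radius of the finite cluster of the origin decays exponentially beyond `L_ε` near
`p = 1/2` (Nolin 2008, §7.5), then `ξ*(p) = |p - 1/2|^{-4/3 + o(1)}` from either side
(`SmirnovWerner2001_truncCorrLength_exponent`), via `L_ε / C₂ ≤ ξ* ≤ (2/c) L_ε`
(`charLength_div_le_triTruncCorrLength_le_of_chain`) and the squeeze of logarithmic ratios. [cite: SmirnovWernerMRL2001, §2 Thm. 1 (iv) and the paragraph following Thm. 1] [cite: Nolin2008, §7.2 Thm. "Critical exponents" (arXiv: Thm. 31), §7.5 (proof of Lemma 44 (arXiv: Lemma 42))] -/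
theorem SmirnovWerner2001_truncCorrLength_exponent_of_chain_charLength {ε : ℝ} (hchain0 : ChainBound ε)
    (hLr : HasRightPowerLaw (fun p => (charLength ε (Set.projIcc (0 : ℝ) 1 zero_le_one p) : ℝ))
      (1 / 2) (-4 / 3))
    (hLl : HasLeftPowerLaw (fun p => (charLength ε (Set.projIcc (0 : ℝ) 1 zero_le_one p) : ℝ))
      (1 / 2) (-4 / 3))
    {δ C c : ℝ} (hδ : 0 < δ) (hC : 0 < C) (hc : 0 < c)
    (hdec : ∀ p : unitInterval, |(p : ℝ) - 1 / 2| < δ → (p : ℝ) ≠ 1 / 2 → 1 ≤ charLength ε p →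
      ∀ k : ℕ, 1 ≤ k → (triSitePercolation p).real
        (triBoxArm (k * charLength ε p) ∩ (sitePercolatesAt triGraph 0)ᶜ) ≤
          C * Real.exp (-(c * k))) :
    SmirnovWerner2001_truncCorrLength_exponent := by
  obtain ⟨C₂, hC₂, hsand⟩ := charLength_div_le_triTruncCorrLength_le_of_chain hchain0
  set Lr : ℝ → ℝ := fun p => (charLength ε (Set.projIcc (0 : ℝ) 1 zero_le_one p) : ℝ) with hLrdef
  -- the common part of the two one-sided statements
  have key : ∀ {l : Filter ℝ}, Tendsto (fun x : ℝ => |x - 1 / 2|) l (𝓝[>] 0) →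
      Tendsto (fun x => Real.log (Lr x) / Real.log |x - 1 / 2|) l (𝓝 (-4 / 3)) →
      Tendsto (fun x => Real.log (triTruncCorrLengthReal x) / Real.log |x - 1 / 2|) l
        (𝓝 (-4 / 3)) := by
    intro l hd hB
    have hB' : ∀ᶠ x in l, 2 ≤ charLength ε (Set.projIcc 0 1 zero_le_one x) := by
      refine (hB.eventually_ne (show (-4 / 3 : ℝ) ≠ 0 by norm_num)).mono fun x hx => ?_
      by_contra h0
      apply hx
      have h0' : charLength ε (Set.projIcc 0 1 zero_le_one x) = 0 ∨
          charLength ε (Set.projIcc 0 1 zero_le_one x) = 1 := by omega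
      have : Real.log (Lr x) = 0 := by
        rcases h0' with h0' | h0' <;>
          simp only [hLrdef, h0', Nat.cast_zero, Nat.cast_one, Real.log_zero, Real.log_one]
      rw [this, zero_div]
    have hLrpos : ∀ᶠ x in l, 0 < Lr x := hB'.mono fun x hx => by
      simp only [hLrdef]; exact_mod_cast (show 0 < _ by omega)
    have hA : Tendsto (fun x => Real.log (Lr x / C₂) / Real.log |x - 1 / 2|) l (𝓝 (-4 / 3)) :=
      tendsto_log_div_const_div hC₂ hd hLrpos hB
    refine tendsto_log_div_of_sandwich (K := 2 / c) (by positivity) hd hA hB ?_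
    have h12 : ∀ᶠ x in l, |x - 1 / 2| ∈ Set.Ioo 0 (min δ (1 / 2)) :=
      hd.eventually_mem (Ioo_mem_nhdsGT (by positivity))
    filter_upwards [h12, hB'] with x hx12 hxB
    obtain ⟨hx0, hx1⟩ := hx12
    have hxδ : |x - 1 / 2| < δ := hx1.trans_le (min_le_left _ _)
    have hx2 : |x - 1 / 2| < 1 / 2 := hx1.trans_le (min_le_right _ _)
    have hxI : x ∈ Set.Icc (0 : ℝ) 1 := by
      rw [abs_lt] at hx2
      constructor <;> linarith [hx2.1, hx2.2]
    have hproj : Set.projIcc 0 1 zero_le_one x = ⟨x, hxI⟩ := Set.projIcc_of_mem _ hxI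
    rw [hproj] at hxB
    simp only [triTruncCorrLengthReal, hLrdef, hproj]
    have hne : ((⟨x, hxI⟩ : unitInterval) : ℝ) ≠ 1 / 2 := fun h => by
      change x = 1 / 2 at h
      rw [h, sub_self, abs_zero] at hx0
      exact lt_irrefl _ hx0
    have hx01 : 0 < x ∧ x < 1 := by
      rw [abs_lt] at hx2
      constructor <;> linarith [hx2.1, hx2.2]
    have hxB1 : 1 ≤ charLength ε ⟨x, hxI⟩ := le_trans (by norm_num) hxB
    obtain ⟨hlow, hub⟩ := hsand ⟨x, hxI⟩ hx01.1 hxB hC hc (hdec ⟨x, hxI⟩ hxδ hne hxB1)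
    have hLpos : (0 : ℝ) < charLength ε ⟨x, hxI⟩ := by exact_mod_cast (show 0 < _ by omega)
    refine ⟨by positivity, hlow, ?_⟩
    calc triTruncCorrLength ⟨x, hxI⟩ ≤ 2 * (charLength ε ⟨x, hxI⟩ : ℝ) / c := hub
      _ = 2 / c * (charLength ε ⟨x, hxI⟩ : ℝ) := by ring
  -- continuity of `x ↦ |x - 1/2|` at `1/2`
  have habs : Tendsto (fun x : ℝ => |x - 1 / 2|) (𝓝 (1 / 2)) (𝓝 0) := by
    have : Continuous fun x : ℝ => |x - 1 / 2| := (continuous_id.sub continuous_const).abs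
    simpa using this.tendsto (1 / 2)
  constructor
  · have heq : ∀ᶠ x in 𝓝[>] (1 / 2 : ℝ), |x - 1 / 2| = x - 1 / 2 :=
      eventually_nhdsWithin_of_forall fun x hx => abs_of_pos (sub_pos.2 hx)
    have hd : Tendsto (fun x : ℝ => |x - 1 / 2|) (𝓝[>] (1 / 2)) (𝓝[>] 0) :=
      tendsto_nhdsWithin_iff.2 ⟨habs.mono_left nhdsWithin_le_nhds,
        eventually_nhdsWithin_of_forall fun x hx =>
          Set.mem_Ioi.2 (abs_pos.2 (sub_ne_zero.2 (ne_of_gt hx)))⟩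
    have hB : Tendsto (fun x => Real.log (Lr x) / Real.log |x - 1 / 2|)
        (𝓝[>] (1 / 2)) (𝓝 (-4 / 3)) :=
      hLr.congr' (heq.mono fun x hx => by simp only [hx])
    exact (key hd hB).congr' (heq.mono fun x hx => by simp only [hx])
  · have heq : ∀ᶠ x in 𝓝[<] (1 / 2 : ℝ), |x - 1 / 2| = 1 / 2 - x :=
      eventually_nhdsWithin_of_forall fun x hx => by
        rw [abs_sub_comm]; exact abs_of_pos (sub_pos.2 hx)
    have hd : Tendsto (fun x : ℝ => |x - 1 / 2|) (𝓝[<] (1 / 2)) (𝓝[>] 0) :=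
      tendsto_nhdsWithin_iff.2 ⟨habs.mono_left nhdsWithin_le_nhds,
        eventually_nhdsWithin_of_forall fun x hx =>
          Set.mem_Ioi.2 (abs_pos.2 (sub_ne_zero.2 (ne_of_lt hx)))⟩
    have hB : Tendsto (fun x => Real.log (Lr x) / Real.log |x - 1 / 2|)
        (𝓝[<] (1 / 2)) (𝓝 (-4 / 3)) :=
      hLl.congr' (heq.mono fun x hx => by simp only [hx])
    exact (key hd hB).congr' (heq.mono fun x hx => by simp only [hx])

/-- **Smirnov–Werner's Thm. 1 (iv) from the power law of `L_ε` and the radius decay, with no RSW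
hypothesis** (`ChainBound ε` is `chainBound_holds`). [cite: SmirnovWernerMRL2001, §2 Thm. 1 (iv)] [cite: Nolin2008, §7.2 Thm. "Critical exponents" (arXiv: Thm. 31), §7.5 (proof of Lemma 44 (arXiv: Lemma 42))] [cite: BollobasRiordan2006, Ch. 3 Lemma 4, Cor. 5] -/
theorem SmirnovWerner2001_truncCorrLength_exponent_of_charLength_decay {ε : ℝ} (hε : 0 < ε) (hε' : ε < 1 / 2)
    (hLr : HasRightPowerLaw (fun p => (charLength ε (Set.projIcc (0 : ℝ) 1 zero_le_one p) : ℝ))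
      (1 / 2) (-4 / 3))
    (hLl : HasLeftPowerLaw (fun p => (charLength ε (Set.projIcc (0 : ℝ) 1 zero_le_one p) : ℝ))
      (1 / 2) (-4 / 3))
    {δ C c : ℝ} (hδ : 0 < δ) (hC : 0 < C) (hc : 0 < c)
    (hdec : ∀ p : unitInterval, |(p : ℝ) - 1 / 2| < δ → (p : ℝ) ≠ 1 / 2 → 1 ≤ charLength ε p →
      ∀ k : ℕ, 1 ≤ k → (triSitePercolation p).real
        (triBoxArm (k * charLength ε p) ∩ (sitePercolatesAt triGraph 0)ᶜ) ≤
          C * Real.exp (-(c * k))) :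
    SmirnovWerner2001_truncCorrLength_exponent :=
  SmirnovWerner2001_truncCorrLength_exponent_of_chain_charLength (chainBound_holds hε hε') hLr hLl
    hδ hC hc hdec

/-- **Smirnov–Werner's Thm. 1 (iv) from the four-arm exponent, Kesten's relation and the radius
decay beyond `L_ε` at one `ε ∈ (0, 1/2)`**: `ξ* ≍ L_ε ≈ |p - 1/2|^{-4/3}`. [cite: SmirnovWernerMRL2001, §2 Thm. 1 (iv) and the paragraph following Thm. 1] [cite: Nolin2008, §7.2 Thm. "Critical exponents" (arXiv: Thm. 31), §7.3 (display after Prop. 34 (arXiv: Prop. 32))] -/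
theorem SmirnovWerner2001_truncCorrLength_exponent_of_charLength_at (h₄ : fourArm_exponent)
    (hK : Nolin2008_prop34) {ε : ℝ} (hε : 0 < ε) (hε' : ε < 1 / 2)
    (hdec : Nolin2008_radius_decay_at ε) : SmirnovWerner2001_truncCorrLength_exponent := by
  obtain ⟨δ, hδ, C, hC, c, hc, hdec⟩ := hdec
  exact SmirnovWerner2001_truncCorrLength_exponent_of_charLength_decay hε hε'
    (hasRightPowerLaw_charLength h₄ hK hε hε') (hasLeftPowerLaw_charLength h₄ hK hε hε') hδ hC hc
    hdec

/-- **The same with the radius decay from Nolin's Lemma 39 at `ε`** (both halves,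
`Nolin2008_radius_decay_at_of_lemma39_at'`): `fourArm_exponent → Nolin2008_prop34 →
Nolin2008_lemma39_at ε → SW (iv)`. [cite: SmirnovWernerMRL2001, §2 Thm. 1 (iv)] [cite: Nolin2008, §7.4 Lemma 39 (arXiv: Lemma 37), §7.5 (proof of Lemma 44 (arXiv: Lemma 42))] -/
theorem SmirnovWerner2001_truncCorrLength_exponent_of_lemma39_at (h₄ : fourArm_exponent)
    (hK : Nolin2008_prop34) {ε : ℝ} (hε : 0 < ε) (hε' : ε < 1 / 2) (h37 : Nolin2008_lemma39_at ε) :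
    SmirnovWerner2001_truncCorrLength_exponent :=
  SmirnovWerner2001_truncCorrLength_exponent_of_charLength_at h₄ hK hε hε'
    (Nolin2008_radius_decay_at_of_lemma39_at' h37)

/-- **Smirnov–Werner's Thm. 1 (iv) from the scaling inputs**: the four-arm exponent, Kesten's
relation and the radius decay beyond `L_ε` stated for every `ε` (`Nolin2008_radius_decay`), at
`ε = 1/4`. [cite: SmirnovWernerMRL2001, §2 Thm. 1 (iv) and the paragraph following Thm. 1] -/
theorem SmirnovWerner2001_truncCorrLength_exponent_of_scaling (h₄ : fourArm_exponent)
    (hK : Nolin2008_prop34) (hdec : Nolin2008_radius_decay) :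
    SmirnovWerner2001_truncCorrLength_exponent :=
  SmirnovWerner2001_truncCorrLength_exponent_of_charLength_at h₄ hK (ε := 1 / 4) (by norm_num)
    (by norm_num) (hdec (1 / 4) (by norm_num) (by norm_num))

/-- **Smirnov–Werner's Thm. 1 (iv) from three leaves**: the four-arm exponent `fourArm_exponent`,
the near-critical pivotal count `Werner2009_lemma62` (whence Kesten's relation,
`Nolin2008_prop34_of_expDecay` with `BollobasRiordan2006_tri_expDecay_holds`) and the "moreover"
part `Nolin2008_RSW_one` of Nolin's RSW theorem (whence Lemma 39 at small `ε`,
`Nolin2008_lemma39_at_of_RSW_one`); at `ε = min ε₀ (1/4)`. [cite: SmirnovWernerMRL2001, §2 Thm. 1 (iv) and the paragraph following Thm. 1] [cite: Nolin2008, §7.3 Prop. 34, §7.4 Lemma 39 (arXiv: Prop. 32, Lemma 37)] [cite: BollobasRiordan2006, Ch. 3 Lemma 4, Cor. 5] -/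
theorem SmirnovWerner2001_truncCorrLength_exponent_of_leaves₃ (h₄ : fourArm_exponent)
    (h62 : Werner2009_lemma62) (hRSW1 : Nolin2008_RSW_one) :
    SmirnovWerner2001_truncCorrLength_exponent := by
  obtain ⟨ε₀, hε₀, h37⟩ := Nolin2008_lemma39_at_of_RSW_one hRSW1
  have h37' : Nolin2008_lemma39_at (min ε₀ (1 / 4)) := h37 _ (min_le_left _ _)
  exact SmirnovWerner2001_truncCorrLength_exponent_of_lemma39_at h₄
    (Nolin2008_prop34_of_expDecay BollobasRiordan2006_tri_expDecay_holds h62)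
    (lt_min hε₀ (by norm_num)) (lt_of_le_of_lt (min_le_right _ _) (by norm_num)) h37'

/-- **Smirnov–Werner's Thm. 1 (iv) from the four-arm exponent, the pivotal count and Nolin's RSW
theorem as printed** (`Nolin2008_RSW_thm`, through `Nolin2008_RSW_one_of_RSW_thm`). [cite: SmirnovWernerMRL2001, §2 Thm. 1 (iv)] [cite: Nolin2008, §3.1 Thm. "Russo–Seymour–Welsh" (arXiv: Thm. 2)] -/
theorem SmirnovWerner2001_truncCorrLength_exponent_of_leaves₃' (h₄ : fourArm_exponent)
    (h62 : Werner2009_lemma62) (h2 : Nolin2008_RSW_thm) :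
    SmirnovWerner2001_truncCorrLength_exponent :=
  SmirnovWerner2001_truncCorrLength_exponent_of_leaves₃ h₄ h62 (Nolin2008_RSW_one_of_RSW_thm h2)

/-! ### Two leaves: Smirnov–Werner's Thm. 1 (iv) from the four-arm exponent and Kesten's relation

Nolin's Lemma 39 / Remark 40 at every small `ε` is a theorem of the tree
(`Nolin2008_lemma39_at_holds_small`, `NearCriticalRSWStart.lean`: the start of Nolin's block
argument from the two-scale Russo–Seymour–Welsh bounds of Bollobás–Riordan, at a scale
`n₀ ≤ L_ε(p)`), so the "moreover" clause `Nolin2008_RSW_one` of the RSW theorem is no longer an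
input of Thm. 1 (iv): the remaining named inputs are the four-arm exponent `5/4`
(`fourArm_exponent`, Smirnov–Werner 2001, Thm. 1 with `j = 4` / Thm. 4) and Kesten's scaling
relation `Nolin2008_prop34` (`|p - 1/2| L_ε(p)² π₄(L_ε(p)) ≍ 1`), exactly as in Smirnov–Werner's
own derivation ("(iv) follows from Kesten's scaling relations … once (iii) holds").
-/

/-- **Smirnov–Werner's Thm. 1 (iv) from the four-arm exponent and Kesten's relation**:
`fourArm_exponent → Nolin2008_prop34 → SW (iv)`, at `ε = min ε₀ (1/4)` with `ε₀` the threshold of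
`Nolin2008_lemma39_at_holds_small` (Lemma 39 unconditionally at small `ε`), through
`SmirnovWerner2001_truncCorrLength_exponent_of_lemma39_at` (`ξ* ≍ L_ε ≈ |p - 1/2|^{-4/3}`). [cite: SmirnovWernerMRL2001, §2 Thm. 1 (iv) and the paragraph following Thm. 1] [cite: Nolin2008, §7.3 Prop. 34, §7.4 Lemma 39 / Remark 40 (arXiv 0711.4948: Prop. 32, Lemma 37 / Remark 38)] [cite: BollobasRiordan2006, Ch. 3 Lemma 4, Cor. 5] -/
theorem SmirnovWerner2001_truncCorrLength_exponent_of_prop34 (h₄ : fourArm_exponent)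
    (hK : Nolin2008_prop34) : SmirnovWerner2001_truncCorrLength_exponent := by
  obtain ⟨ε₀, hε₀, h37⟩ := Nolin2008_lemma39_at_holds_small
  exact SmirnovWerner2001_truncCorrLength_exponent_of_lemma39_at h₄ hK
    (lt_min hε₀ (by norm_num : (0 : ℝ) < 1 / 4))
    (lt_of_le_of_lt (min_le_right _ _) (by norm_num)) (h37 _ (min_le_left _ _))

/-- **Smirnov–Werner's Thm. 1 (iv) from two leaves**: the four-arm exponent `fourArm_exponent`
and the near-critical pivotal count `Werner2009_lemma62` (whence Kesten's relation,
`Nolin2008_prop34_of_expDecay` with `BollobasRiordan2006_tri_expDecay_holds`) — the same two leaves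
as the tree's `triCorrLength_exponent_of_leaves₂` (`NearCriticalRSWStart.lean`) for Thm. 1 (iii)–(iv)
in the radius form. [cite: SmirnovWernerMRL2001, §2 Thm. 1 (iv) and the paragraph following Thm. 1] [cite: Nolin2008, §7.3 Prop. 34, §7.4 Lemma 39 (arXiv 0711.4948: Prop. 32, Lemma 37)] [cite: WernerPCMI2009, Lecture 6, Lemma 6.2] -/
theorem SmirnovWerner2001_truncCorrLength_exponent_of_leaves₂ (h₄ : fourArm_exponent)
    (h62 : Werner2009_lemma62) : SmirnovWerner2001_truncCorrLength_exponent :=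
  SmirnovWerner2001_truncCorrLength_exponent_of_prop34 h₄
    (Nolin2008_prop34_of_expDecay BollobasRiordan2006_tri_expDecay_holds h62)

/-- **Smirnov–Werner's Thm. 1 (iv) from the four-arm exponent and the five named facts of
Werner's Lecture 6** (four-arm stability below `L(p)` `Werner2009_lemma63`, quasi-multiplicativity
`Werner2009_fourArm_quasiMult`, the a-priori lower bound `Werner2009_fourArm_lowerBound`, the
half-plane two-arm bound `Werner2009_halfPlane_twoArm` and the pivotal lower bound
`Werner2009_pivotal_lowerBound`), through Kesten's relation `Nolin2008_prop34_of_wernerFacts`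
(`KestenScalingFromFacts.lean`) — the inputs of the tree's `triTheta_exponent_of_facts` other than
the one-arm exponent. [cite: SmirnovWernerMRL2001, §2 Thm. 1 (iv) and the paragraph following Thm. 1] [cite: WernerPCMI2009, Lecture 6, Lemma 6.2 (proof, lower bound), Cor. 6.3, Lemma 6.3] [cite: Nolin2008, §7.3 Prop. 34 and Remark 35 (arXiv 0711.4948: Prop. 32, Remark 34)] -/
theorem SmirnovWerner2001_truncCorrLength_exponent_of_wernerFacts (h₄ : fourArm_exponent)
    (h63 : Werner2009_lemma63) (hQM : Werner2009_fourArm_quasiMult)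
    (hLB : Werner2009_fourArm_lowerBound) (hHP : Werner2009_halfPlane_twoArm)
    (hP : Werner2009_pivotal_lowerBound) : SmirnovWerner2001_truncCorrLength_exponent :=
  SmirnovWerner2001_truncCorrLength_exponent_of_prop34 h₄
    (Nolin2008_prop34_of_wernerFacts h63 hQM hLB hHP hP)

/-! ### Three leaves: the supercritical radius decay from Kesten's relation and the two critical
four-arm estimates, with no Russo–Seymour–Welsh hypothesis

Nolin's Lemma 39 / Remark 40 at every small `ε` is a theorem of the tree
(`Nolin2008_lemma39_at_holds_small`, `NearCriticalRSWStart.lean`). Consequently: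

* the single-`ε` supercritical radius decay holds UNCONDITIONALLY for every `ε ≤ ε₀`
  (`Nolin2008_radius_decay_supercritical_at_holds_small`) — the range in which Nolin proves
  Lemma 39 directly ("we have proved the property for any `ε` below some fixed value `ε₀`");
* for `ε ∈ (ε₀, 1/2)` the printed proof invokes the equivalence of lengths, Cor. 37 [arXiv:
  Cor. 35], which the tree derives (`charLength_le_mul_charLength_of_scaling`,
  `NearCriticalLengthsEquivalence.lean`) from Kesten's relation `Nolin2008_prop34`
  (`|p - 1/2| L_ε(p)² π₄(L_ε(p)) ≍ 1`, Prop. 34 [arXiv: Prop. 32]) and Werner's two four-arm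
  estimates at `p = 1/2` (`Werner2009_fourArm_quasiMult`, `Werner2009_fourArm_lowerBound`); so
  Lemma 39 at every `ε` (`Nolin2008_lemma39_at_of_scaling`, `Nolin2008_lemma39_of_scaling`) and the
  all-`ε` supercritical display and the all-`ε` fact `Nolin2008_radius_decay` follow from these
  THREE named facts (`…_of_scaling`), or from `Werner2009_lemma62` and the two four-arm estimates
  (`…_of_lemma62`, Kesten's relation from the pivotal count, `Nolin2008_prop34_of_lemma62`), or from
  the five named facts of Werner's Lecture 6 (`…_of_wernerFacts`, through
  `Nolin2008_prop34_of_wernerFacts`).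
-/

/-- **The supercritical radius decay at every small `ε`, unconditionally.** There is `ε₀ > 0`
such that `Nolin2008_radius_decay_supercritical_at ε` holds for every `ε ≤ ε₀`: Nolin's Lemma 39
at small `ε` (`Nolin2008_lemma39_at_holds_small`) and the white-crossing argument
`Nolin2008_radius_decay_supercritical_at_of_lemma39_at`. (For `ε ≤ 0` the statement is vacuous or
trivial and is covered by the same threshold.) [cite: Nolin2008, §7.5 (proof of Lemma 44 (arXiv 0711.4948: Lemma 42), second annulus display), §7.4 Lemma 39 / Remark 40 (arXiv: Lemma 37 / Remark 38)] -/
theorem Nolin2008_radius_decay_supercritical_at_holds_small :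
    ∃ ε₀ : ℝ, 0 < ε₀ ∧ ∀ ε : ℝ, ε ≤ ε₀ → Nolin2008_radius_decay_supercritical_at ε := by
  obtain ⟨ε₀, hε₀, h37⟩ := Nolin2008_lemma39_at_holds_small
  exact ⟨ε₀, hε₀, fun ε hε => Nolin2008_radius_decay_supercritical_at_of_lemma39_at (h37 ε hε)⟩

/-- **Both halves of the radius decay at every small `ε`, unconditionally**: there is `ε₀ > 0`
such that `Nolin2008_radius_decay_at ε` holds for every `ε ≤ ε₀`
(`Nolin2008_radius_decay_at_of_lemma39_at'` with `Nolin2008_lemma39_at_holds_small`). [cite: Nolin2008, §7.5 (proof of Lemma 44 (arXiv 0711.4948: Lemma 42)), §7.4 Lemma 39 / Remark 40 (arXiv: Lemma 37 / Remark 38)] -/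
theorem Nolin2008_radius_decay_at_holds_small :
    ∃ ε₀ : ℝ, 0 < ε₀ ∧ ∀ ε : ℝ, ε ≤ ε₀ → Nolin2008_radius_decay_at ε := by
  obtain ⟨ε₀, hε₀, h37⟩ := Nolin2008_lemma39_at_holds_small
  exact ⟨ε₀, hε₀, fun ε hε => Nolin2008_radius_decay_at_of_lemma39_at' (h37 ε hε)⟩

/-- **Nolin's Lemma 39 / Remark 40 at EVERY `ε < 1/2` from three named facts** — Kesten's relation
`Nolin2008_prop34` and Werner's two critical four-arm estimates `Werner2009_fourArm_quasiMult`,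
`Werner2009_fourArm_lowerBound` — and no Russo–Seymour–Welsh hypothesis: for `ε ≤ ε₀` this is
`Nolin2008_lemma39_at_holds_small`; for `ε ∈ (ε₀, 1/2)`, as in the last paragraph of the printed
proof, the equivalence of lengths `L_{ε₀}(p) ≤ K L_ε(p)` near `1/2`
(`charLength_le_mul_charLength_of_scaling`) through `Nolin2008_lemma39_at_of_charLength_le`.
(`Nolin2008_lemma39_at_of_leaves` with its first leaf `Nolin2008_RSW_one` discharged.) [cite: Nolin2008, §7.4 Lemma 39 / Remark 40 with the last paragraph of the proof, §7.3 Cor. 37 (arXiv 0711.4948: Lemma 37 / Remark 38, Cor. 35)] -/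
theorem Nolin2008_lemma39_at_of_scaling (hK : Nolin2008_prop34)
    (hq : Werner2009_fourArm_quasiMult) (hl : Werner2009_fourArm_lowerBound)
    {ε : ℝ} (hε' : ε < 1 / 2) : Nolin2008_lemma39_at ε := by
  obtain ⟨ε₀, hε₀, h37⟩ := Nolin2008_lemma39_at_holds_small
  by_cases hsmall : ε ≤ ε₀
  · exact h37 ε hsmall
  · have hlt : ε₀ < ε := not_le.1 hsmall
    obtain ⟨K, δ, hδ, hcomp⟩ := charLength_le_mul_charLength_of_scaling hK hq hl hε₀ hlt.le hε'
    refine Nolin2008_lemma39_at_of_charLength_le hε₀ hlt.le (h37 ε₀ le_rfl) hδ (C := K) ?_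
    intro p hp1 hp2
    exact hcomp p hp2.ne (by rw [abs_lt]; constructor <;> linarith)

/-- The fixed-`ε` form `Nolin2008_lemma39_at ε` at every `ε ∈ (0, 1/2)` implies the all-`ε` named
fact `Nolin2008_lemma39` (`NearCriticalArm.lean`): for `ε < p < 1/2` the guard `1 ≤ L_ε(p)` of the
fixed-`ε` form is met (`one_le_charLength`, with the proved sub-critical decay
`Nolin2008_subcritical_crossing_holds`). [cite: Nolin2008, §7.4 Lemma 39 / Remark 40 (arXiv 0711.4948: Lemma 37 / Remark 38)] -/
theorem Nolin2008_lemma39_of_forall_at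
    (h : ∀ ⦃ε : ℝ⦄, 0 < ε → ε < 1 / 2 → Nolin2008_lemma39_at ε) : Nolin2008_lemma39 := by
  intro ε hε hε' k hk
  obtain ⟨C₁, hC₁, C₂, hC₂, hb⟩ := h hε hε' k hk
  exact ⟨C₁, hC₁, C₂, hC₂, fun p hεp hp n _ =>
    hb p hp (one_le_charLength Nolin2008_subcritical_crossing_holds hε hεp hp) n⟩

/-- **The named fact `Nolin2008_lemma39` (Lemma 39 / Remark 40 at every `ε ∈ (0, 1/2)`) from three
named facts**: `Nolin2008_prop34`, `Werner2009_fourArm_quasiMult`, `Werner2009_fourArm_lowerBound`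
(`Nolin2008_lemma39_at_of_scaling`, `Nolin2008_lemma39_of_forall_at`). Compare
`Nolin2008_lemma39_of_prop34` (`CharLengthEquivalence.lean`, the same with `Nolin2008_RSW_one` as a
fourth hypothesis) and `Nolin2008_lemma39_of_wernerFacts` (`KestenScalingThetaFromFacts.lean`, from
Werner's five facts). [cite: Nolin2008, §7.4 Lemma 39 / Remark 40, §7.3 Cor. 37 (arXiv 0711.4948: Lemma 37 / Remark 38, Cor. 35)] -/
theorem Nolin2008_lemma39_of_scaling (hK : Nolin2008_prop34)
    (hq : Werner2009_fourArm_quasiMult) (hl : Werner2009_fourArm_lowerBound) :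
    Nolin2008_lemma39 :=
  Nolin2008_lemma39_of_forall_at fun _ _ hε' => Nolin2008_lemma39_at_of_scaling hK hq hl hε'

/-- **The supercritical radius decay at every `ε ∈ (0, 1/2)` from three named facts** (Kesten's
relation `Nolin2008_prop34` and Werner's two critical four-arm estimates, the second of which is
proved, `Werner2009_fourArm_lowerBound_holds`), with no Russo–Seymour–Welsh hypothesis: Lemma 39 at
every `ε` (`Nolin2008_lemma39_at_of_scaling`) and the white-crossing argument
(`Nolin2008_radius_decay_supercritical_at_of_lemma39_at`); the restriction to `p > 1/2` of
`Nolin2008_radius_decay_of_scaling`. [cite: Nolin2008, §7.5 (proof of Lemma 44 (arXiv 0711.4948: Lemma 42), second annulus display), §7.4 Lemma 39 / Remark 40, §7.3 Prop. 34 and Cor. 37 (arXiv: Lemma 37 / Remark 38, Prop. 32, Cor. 35)] [cite: WernerPCMI2009, Lecture 6, §3 and Cor. 6.2] -/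
theorem Nolin2008_radius_decay_supercritical_of_scaling (hK : Nolin2008_prop34)
    (hq : Werner2009_fourArm_quasiMult) (hl : Werner2009_fourArm_lowerBound) :
    ∀ ε : ℝ, 0 < ε → ε < 1 / 2 → Nolin2008_radius_decay_supercritical_at ε := fun _ _ hε' =>
  Nolin2008_radius_decay_supercritical_at_of_lemma39_at
    (Nolin2008_lemma39_at_of_scaling hK hq hl hε')

/-- **`Nolin2008_radius_decay` (both halves, every `ε ∈ (0, 1/2)`) from three named facts**
(`Nolin2008_radius_decay_of_leaves` with its first leaf `Nolin2008_RSW_one` discharged). [cite: Nolin2008, §7.5 (proof of Lemma 44 (arXiv 0711.4948: Lemma 42)), §7.4 Lemma 39, §7.3 Prop. 34 and Cor. 37 (arXiv: Lemma 37, Prop. 32, Cor. 35)] [cite: WernerPCMI2009, Lecture 6, §3 and Cor. 6.2] -/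
theorem Nolin2008_radius_decay_of_scaling (hK : Nolin2008_prop34)
    (hq : Werner2009_fourArm_quasiMult) (hl : Werner2009_fourArm_lowerBound) :
    Nolin2008_radius_decay := fun _ _ hε' =>
  Nolin2008_radius_decay_at_of_lemma39_at' (Nolin2008_lemma39_at_of_scaling hK hq hl hε')

/-- **The supercritical radius decay at every `ε ∈ (0, 1/2)` from the pivotal count and the two
four-arm estimates**: as `Nolin2008_radius_decay_supercritical_of_scaling`, with Kesten's relation supplied
by Werner's Lemma 6.2 (`Werner2009_lemma62`, through `Nolin2008_prop34_of_lemma62`). [cite: Nolin2008, §7.5 (proof of Lemma 44 (arXiv 0711.4948: Lemma 42)), §7.3 Prop. 34 and Cor. 37 (arXiv: Prop. 32, Cor. 35)] [cite: WernerPCMI2009, Lecture 6, Lemma 6.2, §3 and Cor. 6.2] -/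
theorem Nolin2008_radius_decay_supercritical_of_lemma62 (h62 : Werner2009_lemma62)
    (hq : Werner2009_fourArm_quasiMult) (hl : Werner2009_fourArm_lowerBound) :
    ∀ ε : ℝ, 0 < ε → ε < 1 / 2 → Nolin2008_radius_decay_supercritical_at ε :=
  Nolin2008_radius_decay_supercritical_of_scaling (Nolin2008_prop34_of_lemma62 h62) hq hl

/-- **The supercritical radius decay at every `ε ∈ (0, 1/2)` from the five named facts of Werner's Lecture 6**
(four-arm stability below `L(p)` `Werner2009_lemma63`, quasi-multiplicativity
`Werner2009_fourArm_quasiMult`, the a-priori lower bound `Werner2009_fourArm_lowerBound`, the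
half-plane two-arm bound `Werner2009_halfPlane_twoArm`, the pivotal lower bound
`Werner2009_pivotal_lowerBound`): Kesten's relation from the facts
(`Nolin2008_prop34_of_wernerFacts`, `KestenScalingFromFacts.lean`), then `…_of_scaling`.
Equivalently, `Nolin2008_radius_decay_supercritical_of_lemma39` with
`Nolin2008_lemma39_of_wernerFacts` (`KestenScalingThetaFromFacts.lean`). [cite: Nolin2008, §7.5 (proof of Lemma 44 (arXiv 0711.4948: Lemma 42)), §7.3 Prop. 34, Remark 35 and Cor. 37 (arXiv: Prop. 32, Remark 34, Cor. 35)] [cite: WernerPCMI2009, Lecture 6, Lemma 6.2 (proof, lower bound), Cor. 6.3, Lemma 6.3, §3 and Cor. 6.2] -/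
theorem Nolin2008_radius_decay_supercritical_of_wernerFacts (h63 : Werner2009_lemma63)
    (hQM : Werner2009_fourArm_quasiMult) (hLB : Werner2009_fourArm_lowerBound)
    (hHP : Werner2009_halfPlane_twoArm) (hP : Werner2009_pivotal_lowerBound) :
    ∀ ε : ℝ, 0 < ε → ε < 1 / 2 → Nolin2008_radius_decay_supercritical_at ε :=
  Nolin2008_radius_decay_supercritical_of_scaling
    (Nolin2008_prop34_of_wernerFacts h63 hQM hLB hHP hP) hQM hLB

end Literature.Probability.Percolation
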